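import Mathlib
import Literature.Combinatorics.Additive.TripleProductProperty
import Literature.Computability.Complexity.CNFRelabel
import Literature.Computability.Complexity.LRATImport

/-!
# SAT certificates for "no hosted TPP triple of volume `> V`" (small-`n` census of the cruxes
`HyperoctahedralThreshold` / `HyperoctahedralSubsets` / `PolynomialSlack`)

Given three *hosts* `E i : Fin N → G` (enumerations of three finite subsets of a group `G`,
typically the centralisers `C(μ_i)` of three fixed-point-free involutions of `S_n`, or all of
`S_n`), pairwise packing constants `P` and a volume threshold `V`, the CNF `HostData.certCNF`
below is satisfied by (the indicator assignment of) every triple of index sets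
`I i ⊆ Fin N` such that

* `1 ∈ X i := E i '' I i` (WLOG by right translation inside a subgroup host),
* `(X 0, X 1, X 2)` has the triple product property,
* `|X i| · |X j| ≤ P (i, j)` for the three pairs (pair packing, a CONSEQUENCE of the TPP:
  `HostData.card_mul_card_le_pairCount`), and
* `|X 0| · |X 1| · |X 2| > V`

(`HostData.certCNF_satisfiable_of_triple`).  Hence an UNSAT certificate for `certCNF`
(imported through `Literature.Computability.Complexity.LRATImport`, lane A or B) proves that
every hosted TPP triple has volume `≤ V` (`HostData.volume_le_of_unsat`).  Only this direction
(real triple ⇒ satisfying assignment) is needed and proved; the converse is not claimed.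

Encoding (variables `HVar N`): membership bits `x i a`; quotient-set bits `p i c`
(`c ∈ Q(I i)`, `Q(I) = {q a b = "index of E a · (E b)⁻¹"}`), forced by `x i a ∧ x i b → p i (q a b)`;
one clause `¬p 0 a ∨ ¬p 1 b ∨ ¬p 2 c` per *bad* index triple (`E 0 a · E 1 b · E 2 c = 1`, not all
the identity) — the quotient-set form of the TPP (Cohn–Umans 2003, Def. 2.1); unary sequential
counters `r i t j` ("at least `j` of the first `t` membership bits of host `i`", Sinz 2005, both
directions of the recurrences, which a genuine count satisfies); pair-packing clauses and
"volume `> V`" through selector bits `g a b` (exact sizes `(a+1, b+1)` of the first two sets force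
`|X 2| ≥ V / ((a+1)(b+1)) + 1`).  Variables are numbered by flattening
`Fin 4 × Fin 3 × Fin (N+1) × Fin (N+1)` with `finProdFinEquiv` (injective for free).

References: H. Cohn, C. Umans, FOCS 2003, Def. 2.1 (TPP via quotient sets); C. Sinz, CP 2005, §2
(sequential counter); certificate import: `LRATImport.lean` (Cruz-Filipe et al. 2017).
-/

namespace Summit.MatrixMultiplication.MatrixMultiplication.Theorems.HyperoctahedralThreshold.Negative

set_option linter.dupNamespace false

open Literature.Computability.Complexity Literature.Combinatorics.Additive

/-! ## Host data and index-level quotient tables -/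

/-- Three enumerated hosts of common size `N` in a group `G`, with the index of the identity in
each. [folklore] -/
structure HostData (G : Type*) [Group G] [DecidableEq G] (N : ℕ) where
  /-- the enumerations -/
  E : Fin 3 → Fin N → G
  /-- index of the identity element in each host -/
  one : Fin 3 → Fin N

namespace HostData

variable {G : Type*} [Group G] [DecidableEq G] {N : ℕ} (D : HostData G N)

/-- Index of `E i a · (E i b)⁻¹` in host `i` (default `a` if absent — never used under closure).
[folklore] -/
def q (i : Fin 3) (a b : Fin N) : Fin N :=
  ((List.finRange N).find? fun c => decide (D.E i c = D.E i a * (D.E i b)⁻¹)).getD a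

/-- The *bad* index triples: `E 0 a · E 1 b · E 2 c = 1` and not all three the identity index
(the third index is determined; `Fin.find` picks it). [cite: CohnUmans2003, Def. 2.1] -/
def bad : List (Fin N × Fin N × Fin N) :=
  (List.finRange N).flatMap fun a => (List.finRange N).filterMap fun b =>
    match (List.finRange N).find? fun c => decide (D.E 0 a * D.E 1 b * D.E 2 c = 1) with
    | some c => if a = D.one 0 ∧ b = D.one 1 ∧ c = D.one 2 then none else some (a, b, c)
    | none => none

/-- Members of `bad` multiply to `1` and are not the all-identity triple. [folklore] -/
theorem mem_bad {t : Fin N × Fin N × Fin N} (ht : t ∈ D.bad) :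
    D.E 0 t.1 * D.E 1 t.2.1 * D.E 2 t.2.2 = 1 ∧ ¬ (t.1 = D.one 0 ∧ t.2.1 = D.one 1 ∧ t.2.2 = D.one 2) := by
  simp only [bad, List.mem_flatMap, List.mem_finRange, true_and, List.mem_filterMap] at ht
  obtain ⟨a, b, hb⟩ := ht
  split at hb
  · rename_i c hc
    by_cases hif : (a = D.one 0 ∧ b = D.one 1 ∧ c = D.one 2)
    · rw [if_pos hif] at hb; simp at hb
    · rw [if_neg hif] at hb
      simp only [Option.some.injEq] at hb
      subst hb
      exact ⟨by simpa using List.find?_some hc, hif⟩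
  · simp at hb

/-- The index quotient set of an index set. [folklore] -/
def Qidx (i : Fin 3) (I : Finset (Fin N)) : Finset (Fin N) :=
  Finset.image₂ (D.q i) I I

/-- **Index-level TPP**: no bad triple lies in the three index quotient sets.
[cite: CohnUmans2003, Def. 2.1] -/
def IndexTPP (I : Fin 3 → Finset (Fin N)) : Prop :=
  ∀ t ∈ D.bad, ¬ (t.1 ∈ D.Qidx 0 (I 0) ∧ t.2.1 ∈ D.Qidx 1 (I 1) ∧ t.2.2 ∈ D.Qidx 2 (I 2))

/-- Under closure of host `i` under `x y⁻¹`, the table `q` is correct. [folklore] -/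
theorem E_q (hcl : ∀ i a b, ∃ c, D.E i c = D.E i a * (D.E i b)⁻¹) (i : Fin 3) (a b : Fin N) :
    D.E i (D.q i a b) = D.E i a * (D.E i b)⁻¹ := by
  unfold q
  have hs : ((List.finRange N).find? fun c => decide (D.E i c = D.E i a * (D.E i b)⁻¹)).isSome := by
    rw [List.find?_isSome]
    obtain ⟨c, hc⟩ := hcl i a b
    exact ⟨c, List.mem_finRange c, by simpa using hc⟩
  obtain ⟨c, hc⟩ := Option.isSome_iff_exists.1 hs
  rw [hc, Option.getD_some]
  simpa using List.find?_some hc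

/-- With an injective enumeration containing `1` at `one i`, `q a a = one i`. [folklore] -/
theorem q_self (hinj : ∀ i, Function.Injective (D.E i)) (hone : ∀ i, D.E i (D.one i) = 1)
    (i : Fin 3) (a : Fin N) : D.q i a a = D.one i := by
  unfold q
  have hs : ((List.finRange N).find? fun c => decide (D.E i c = D.E i a * (D.E i a)⁻¹)).isSome := by
    rw [List.find?_isSome]
    exact ⟨D.one i, List.mem_finRange _, by simp [hone]⟩
  obtain ⟨c, hc⟩ := Option.isSome_iff_exists.1 hs
  rw [hc, Option.getD_some]
  have h1 : D.E i c = D.E i a * (D.E i a)⁻¹ := by simpa using List.find?_some hc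
  rw [mul_inv_cancel, ← hone i] at h1
  exact hinj i h1

/-! ## Variables and their numbering -/

/-- Variables of the certificate CNF for hosts of size `N`. [folklore] -/
inductive HVar (N : ℕ) where
  /-- membership bit: element `a` of host `i` is in the set -/
  | x (i : Fin 3) (a : Fin N)
  /-- quotient bit: index `c` lies in the quotient set of set `i` -/
  | p (i : Fin 3) (c : Fin N)
  /-- counter bit: at least `j` of the first `t` elements of host `i` are in the set -/
  | r (i : Fin 3) (t j : Fin (N + 1))
  /-- selector bit: the first two sets have exact sizes `a+1`, `b+1` -/
  | g (a b : Fin N)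
  deriving DecidableEq

/-- Flat numbering of the variables through `Fin 4 × Fin 3 × Fin (N+1) × Fin (N+1)`. [folklore] -/
def HVar.tuple {N : ℕ} : HVar N → Fin 4 × Fin 3 × Fin (N + 1) × Fin (N + 1)
  | .x i a => (0, i, a.castSucc, 0)
  | .p i c => (1, i, c.castSucc, 0)
  | .r i t j => (2, i, t, j)
  | .g a b => (3, 0, a.castSucc, b.castSucc)

/-- `HVar.tuple` is injective. [folklore] -/
theorem HVar.tuple_injective {N : ℕ} : Function.Injective (HVar.tuple (N := N)) := by
  intro v w h
  cases v <;> cases w <;> simp_all [HVar.tuple, Fin.castSucc_inj]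

/-- The variable number (DIMACS variable = this `+ 1`). [folklore] -/
def HVar.code {N : ℕ} (v : HVar N) : ℕ :=
  (finProdFinEquiv (finProdFinEquiv (finProdFinEquiv (v.tuple.1, v.tuple.2.1), v.tuple.2.2.1),
    v.tuple.2.2.2)).val

/-- `HVar.code` is injective. [folklore] -/
theorem HVar.code_injective {N : ℕ} : Function.Injective (HVar.code (N := N)) := by
  intro v w h
  have h' := Fin.val_injective h
  simp only [EmbeddingLike.apply_eq_iff_eq, Prod.mk.injEq] at h'
  apply HVar.tuple_injective
  obtain ⟨⟨⟨h1, h2⟩, h3⟩, h4⟩ := h'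
  exact Prod.ext h1 (Prod.ext h2 (Prod.ext h3 h4))

/-! ## The clause families -/

section families
variable (N)

/-- positive / negative literal helpers -/
abbrev pos (v : HVar N) : Literal (HVar N) := (v, true)
/-- negative literal -/
abbrev neg (v : HVar N) : Literal (HVar N) := (v, false)

end families

/-- Size bit "at least `j` elements in set `i`" (the last column of the counter). [folklore] -/
def S (i : Fin 3) (j : Fin (N + 1)) : HVar N := .r i (Fin.last N) j

/-- Defining clauses `x i a ∧ x i b → p i (q a b)` for `a ≠ b`, plus the units `p i (one i)` and
`x i (one i)`. [cite: CohnUmans2003, Def. 2.1] -/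
def quotClauses : CNF (HVar N) :=
  (List.finRange 3).flatMap fun i =>
    [[pos N (.p i (D.one i))], [pos N (.x i (D.one i))]] ++
    (List.finRange N).flatMap fun a => (List.finRange N).filterMap fun b =>
      if a = b then none else some [neg N (.x i a), neg N (.x i b), pos N (.p i (D.q i a b))]

/-- One clause per bad triple. [cite: CohnUmans2003, Def. 2.1] -/
def tppClauses : CNF (HVar N) :=
  D.bad.map fun t => [neg N (.p 0 t.1), neg N (.p 1 t.2.1), neg N (.p 2 t.2.2)]

/-- Sequential unary counters, all four recurrence directions plus the boundary units.
[cite: Sinz2005, §2] -/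
def counterClauses (N : ℕ) : CNF (HVar N) :=
  (List.finRange 3).flatMap fun i =>
    ((List.finRange (N + 1)).map fun t => [pos N (.r i t 0)]) ++
    ((List.finRange N).map fun j => [neg N (.r i 0 j.succ)]) ++
    (List.finRange N).flatMap fun t => (List.finRange N).flatMap fun j =>
      [[neg N (.r i t.castSucc j.succ), pos N (.r i t.succ j.succ)],
       [neg N (.x i t), neg N (.r i t.castSucc j.castSucc), pos N (.r i t.succ j.succ)],
       [neg N (.r i t.succ j.succ), pos N (.r i t.castSucc j.succ), pos N (.x i t)],
       [neg N (.r i t.succ j.succ), pos N (.r i t.castSucc j.castSucc)]]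

/-- The three host pairs. [folklore] -/
def pairs : List (Fin 3 × Fin 3) := [(0, 1), (1, 2), (2, 0)]

/-- Pair-packing clauses: `|X i| ≥ a → |X j| ≤ P/a` and symmetrically, for the three pairs.
[cite: CohnUmans2003, Lemma 3.1] -/
def ppClauses (N : ℕ) (P : Fin 3 × Fin 3 → ℕ) : CNF (HVar N) :=
  pairs.flatMap fun ij =>
    ((List.finRange N).filterMap fun a =>
      let b := P ij / (a.val + 1) + 1
      if h : b < N + 1 then some [neg N (S ij.1 a.succ), neg N (S ij.2 ⟨b, h⟩)] else none) ++
    ((List.finRange N).filterMap fun b =>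
      let a := P ij / (b.val + 1) + 1
      if h : a < N + 1 then some [neg N (S ij.2 b.succ), neg N (S ij.1 ⟨a, h⟩)] else none)

/-- The third size forced by selector `(a, b)` (exact sizes `a+1`, `b+1`): `V / ((a+1)(b+1)) + 1`.
[folklore] -/
def third (V : ℕ) (a b : Fin N) : ℕ := V / ((a.val + 1) * (b.val + 1)) + 1

/-- Volume clauses: selector `g a b` forces `|X 0| ≥ a+1`, `|X 1| ≥ b+1`, `|X 2| ≥ third V a b`;
one selector must be on (among those whose third size fits). [folklore] -/
def volClauses (N V : ℕ) : CNF (HVar N) :=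
  ((List.finRange N).flatMap fun a => (List.finRange N).flatMap fun b =>
    if h : third V a b < N + 1 then
      [[neg N (.g a b), pos N (S 0 a.succ)], [neg N (.g a b), pos N (S 1 b.succ)],
       [neg N (.g a b), pos N (S 2 ⟨third V a b, h⟩)]]
    else [[neg N (.g a b)]]) ++
  [((List.finRange N).flatMap fun a => (List.finRange N).filterMap fun b =>
    if third V a b < N + 1 then some (pos N (.g a b)) else none)]

/-- **The certificate CNF** over `HVar N`. [folklore] -/
def rawCNF (P : Fin 3 × Fin 3 → ℕ) (V : ℕ) : CNF (HVar N) :=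
  D.quotClauses ++ D.tppClauses ++ counterClauses N ++ ppClauses N P ++ volClauses N V

/-- **The certificate CNF over `ℕ`** (DIMACS-ready; feed `CNF.toDimacs` of it to the solver).
[folklore] -/
def certCNF (P : Fin 3 × Fin 3 → ℕ) (V : ℕ) : CNF ℕ :=
  (D.rawCNF P V).relabel HVar.code

/-! ## The canonical assignment of an index triple and the completeness theorem -/

/-- Number of elements of `I` among the first `t` indices. [folklore] -/
def cnt (I : Finset (Fin N)) (t : ℕ) : ℕ := (I.filter fun a => a.val < t).card


/-- The canonical assignment of an index triple `I`. [folklore] -/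
def assignment (I : Fin 3 → Finset (Fin N)) : HVar N → Bool
  | .x i a => decide (a ∈ I i)
  | .p i c => decide (c ∈ D.Qidx i (I i))
  | .r i t j => decide (j.val ≤ cnt (I i) t.val)
  | .g a b => decide (a.val + 1 = (I 0).card ∧ b.val + 1 = (I 1).card)

/-! ## From group-level TPP triples to index triples -/

/-- The right quotient pair count of two hosts: `|{x⁻¹ y : x ∈ host i, y ∈ host j}|`.
[cite: CohnUmans2003, Lemma 3.1] -/
def pairCount (i j : Fin 3) : ℕ :=
  (Finset.image₂ (fun x y => x⁻¹ * y) (Finset.univ.image (D.E i)) (Finset.univ.image (D.E j))).card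

/-- The pair bounds a TPP triple hosted by `D` satisfies: `P (i,j) = pairCount i j`. [folklore] -/
def pairBounds (ij : Fin 3 × Fin 3) : ℕ := D.pairCount ij.1 ij.2

end HostData

end Summit.MatrixMultiplication.MatrixMultiplication.Theorems.HyperoctahedralThreshold.Negative
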